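import Literature.Geometry.Lorentzian.Stationary
import Literature.Geometry.Lorentzian.CausalityOpennessProofs
import Literature.Geometry.Lorentzian.CausalityChronologyProofs
import Literature.Geometry.Lorentzian.CausalityAchronalProofs
import Literature.Geometry.Lorentzian.CausalityPushUp
import Literature.Geometry.Manifold.CompactSupportFlow
import Mathlib.AlgebraicTopology.FundamentalGroupoid.SimplyConnected
import Mathlib.Topology.Homotopy.Path
import Mathlib.Geometry.Manifold.PartitionOfUnity
import HarnessLib

/-!
# Crux `HawkingExtensionIsKerr` (stmt-FinalStateConjecture-17840), line `SketchIdeator2` —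
# programme TOP, brick TOP-D: `doc ∪ 𝓔⁺` is simply connected when `doc` is

Worker file for the registered stub `stub_top_closure` (lead c8).  For a FUTURE-PRESENTED
stationary black hole (`I⁺(M_ext) = M`) the domain of outer communications is the past set
`doc = I⁻(M_ext)` (open) and the future event horizon is its frontier, so
`doc ∪ 𝓔⁺ = cl I⁻(M_ext)`.  The closure of a simply connected chronological past `C = I⁻(A)` is
simply connected:

* `exists_pastPush` — the PUSH: for a compact `K` and a closed `Z` disjoint from it there is a
  continuous `P : ℝ × M → M`, the backward flow of the compactly supported field `β • T` (`T` the
  orienting timelike field, `β` a smooth cutoff, `β = 1` on `K`, `β = 0` on `Z`; complete by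
  `Literature.Geometry.Manifold.exists_contMDiff_globalFlow_of_eq_zero_off_isCompact`), with
  `P₀ = id`, `P_t = id` on `Z`, `P_t (cl C) ⊆ cl C` and `P_t (C) ⊆ C` for `t ≥ 0`, and
  `P_t (K ∩ cl C) ⊆ C` for `t > 0`: a point with `β ≠ 0` is joined to `P_t` of itself by a
  future timelike curve (a flow line, along which `β` never vanishes), and `x ≪ r ∈ cl I⁻(A)`
  forces `x ∈ I⁻(A)` (`I⁺(x)` is open, `≪` is transitive);
* `isPathConnected_closure_chronologicalPast`, `simplyConnectedSpace_closure_chronologicalPast` —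
  every point / loop of `cl C` is pushed into `C` inside `cl C` (loops based at a point `x₀ ∈ C`,
  kept fixed by `β x₀ = 0`; loop points inside the open `C` stay in `C`, loop points off `C` have
  `β = 1` and are pushed into `C`), where it contracts; a single base point suffices in a path
  connected space (`simplyConnectedSpace_of_loops_nullhomotopic_at`);
* `stub_top_closure` — the registered signature.
-/

noncomputable section

set_option linter.dupNamespace false

namespace Summit.FinalStateConjecture.FinalStateConjecture.Theorems.HawkingExtensionIsKerr.SketchIdeator2

open Set Filter Function Literature.Geometry.Lorentzian
open scoped Manifold ContDiff Topology

/-! ## A single base point suffices -/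

/-- **Simple connectedness from the loops at ONE base point.**  A path connected space all of whose
loops at some point `y₀` are null-homotopic is simply connected (conjugate a loop at `x` by a path
from `y₀`; Mathlib's `simply_connected_iff_loops_nullhomotopic` asks for every base point). -/
theorem simplyConnectedSpace_of_loops_nullhomotopic_at {Y : Type*} [TopologicalSpace Y]
    [PathConnectedSpace Y] (y₀ : Y) (h : ∀ γ : Path y₀ y₀, γ.Homotopic (Path.refl y₀)) :
    SimplyConnectedSpace Y := by
  rw [simply_connected_iff_loops_nullhomotopic]
  refine ⟨inferInstance, fun x γ => ?_⟩
  let c : Path y₀ x := PathConnectedSpace.somePath y₀ x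
  have h1 := h ((c.trans γ).trans c.symm)
  rw [← Path.Homotopic.Quotient.eq] at h1 ⊢
  simp only [Path.Homotopic.Quotient.mk_trans, Path.Homotopic.Quotient.mk_symm,
    Path.Homotopic.Quotient.mk_refl] at h1 ⊢
  have h2 : Path.Homotopic.Quotient.trans (.mk c) (.mk γ) = .mk c := by
    have h3 := congrArg (fun δ => Path.Homotopic.Quotient.trans δ (.mk c)) h1
    simpa only [Path.Homotopic.Quotient.trans_assoc, Path.Homotopic.Quotient.symm_trans,
      Path.Homotopic.Quotient.trans_refl, Path.Homotopic.Quotient.refl_trans] using h3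
  have h4 := congrArg (fun δ => Path.Homotopic.Quotient.trans (.symm (.mk c)) δ) h2
  simpa only [← Path.Homotopic.Quotient.trans_assoc, Path.Homotopic.Quotient.symm_trans,
    Path.Homotopic.Quotient.refl_trans] using h4

/-! ## The past-directed push of a chronological past -/

section General

variable {E : Type*} [NormedAddCommGroup E] [NormedSpace ℝ E] [FiniteDimensional ℝ E]
  {H : Type*} [TopologicalSpace H] {I : ModelWithCorners ℝ E H} {n : ℕ∞ω}
  {M : Type*} [TopologicalSpace M] [ChartedSpace H M] [IsManifold I ∞ M]
  [T2Space M] [SecondCountableTopology M] [BoundarylessManifold I M]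
  {g : LorentzianMetric I n M} {τ : TimeOrientation g}

omit [FiniteDimensional ℝ E] [T2Space M] [SecondCountableTopology M] in
/-- **`x ≪ r` with `r ∈ cl I⁻(A)` gives `x ∈ I⁻(A)`**: the open set `I⁺(x)` contains `r`, hence
meets `I⁻(A)` at some `w`, and `x ≪ w ∈ I⁻(A)` gives `x ∈ I⁻(A)` by transitivity of `≪`
(local copy of the preliminary lemma of `EventHorizonGenerators.lean`, kept private to keep the
import cone light). -/
private theorem mem_chronologicalPast_of_mem_closure {A : Set M} {x r : M}
    (hr : r ∈ closure (g.chronologicalPast τ A)) (hxr : r ∈ g.chronologicalFuture τ {x}) :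
    x ∈ g.chronologicalPast τ A := by
  obtain ⟨w, hwx, hwA⟩ := mem_closure_iff.1 hr _
    (LorentzianMetric.isOpen_chronologicalFuture_of_boundaryless g τ {x}) hxr
  exact LorentzianMetric.mem_chronologicalFuture_trans (τ := τ.reverse) hwA
    (LorentzianMetric.mem_chronologicalPast_of_mem_chronologicalFuture hwx)

/-- **The past-directed push.**  On a Hausdorff, second countable, finite-dimensional manifold
without boundary with a `Cⁿ` (`n ≥ 1`) time-oriented Lorentzian metric, let `C = I⁻(A)`, `K`
compact and `Z` closed with `Z ∩ K = ∅`.  There is a continuous `P : ℝ × M → M` — `P (t, ·)` is the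
time-`(-t)` map of the global flow of the compactly supported `C¹` field `β • T` (`β : M → [0, 1]`
smooth, `β = 0` on `Z` and off a compact neighbourhood of `K`, `β = 1` on `K`) — with `P (0, ·) = id`,
`P (t, ·) = id` on `Z`, `P (t, cl C) ⊆ cl C` and `P (t, C) ⊆ C` for `t ≥ 0`, and
`P (t, K ∩ cl C) ⊆ C` for `t > 0`.  Along a flow line `β` never vanishes unless it vanishes
initially (zeros of the field are fixed points), so a point `p` with `β p ≠ 0` is the future
endpoint of the future timelike flow segment from `P (t, p)`, `t > 0`; and `x ≪ p ∈ cl C` forces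
`x ∈ C`. -/
theorem exists_pastPush (hn : 1 ≤ n) (A : Set M) {K Z : Set M} (hK : IsCompact K)
    (hZ : IsClosed Z) (hZK : Disjoint Z K) :
    ∃ P : ℝ × M → M, Continuous P ∧ (∀ p, P (0, p) = p) ∧ (∀ p ∈ Z, ∀ t, P (t, p) = p) ∧
      (∀ p ∈ closure (g.chronologicalPast τ A), ∀ t : ℝ, 0 ≤ t →
        P (t, p) ∈ closure (g.chronologicalPast τ A)) ∧
      (∀ p ∈ g.chronologicalPast τ A, ∀ t : ℝ, 0 ≤ t → P (t, p) ∈ g.chronologicalPast τ A) ∧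
      (∀ p ∈ K ∩ closure (g.chronologicalPast τ A), ∀ t : ℝ, 0 < t →
        P (t, p) ∈ g.chronologicalPast τ A) := by
  haveI : LocallyCompactSpace M := Manifold.locallyCompact_of_finiteDimensional (M := M) I
  haveI : SigmaCompactSpace M := sigmaCompactSpace_of_locallyCompact_secondCountable
  set C : Set M := g.chronologicalPast τ A with hC
  -- an open neighbourhood `W ⊇ K` with compact closure, and the cutoff `β`
  obtain ⟨W, hWo, hKW, hWc⟩ := exists_isOpen_superset_and_isCompact_closure hK
  obtain ⟨β, hβ0, hβ1, hβ01⟩ := exists_contMDiffMap_zero_one_of_isClosed I (n := 1)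
    (hZ.union hWo.isClosed_compl) hK.isClosed
    (disjoint_union_left.2 ⟨hZK, disjoint_compl_left_iff.2 hKW⟩)
  have hβnn : ∀ x, 0 ≤ β x := fun x => (hβ01 x).1
  -- the field `V = β • T`, `C¹`, vanishing off `closure W`
  set V : Π x : M, TangentSpace I x := fun x => (β x : ℝ) • τ.vectorField x with hV
  have hβs : ContMDiff I 𝓘(ℝ, ℝ) 1 β := β.contMDiff
  have hVs : ContMDiff I I.tangent 1 fun x => (⟨x, V x⟩ : TangentBundle I M) :=
    hβs.smul_section (τ.contMDiff.of_le hn)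
  have hV0 : ∀ x, x ∉ closure W → V x = 0 := by
    intro x hx
    have hb : β x = 0 := hβ0 (Or.inr fun h => hx (subset_closure h))
    simp only [hV, hb, zero_smul]
  -- its global flow
  obtain ⟨θ, hθc, hθ0, hθadd, hθint, hθfix⟩ :=
    Literature.Geometry.Manifold.exists_contMDiff_globalFlow_of_eq_zero_off_isCompact (n := 1) hVs
      le_rfl hWc hV0
  -- zeros of `β` are fixed points
  have hfixβ : ∀ p, β p = 0 → ∀ t, θ (t, p) = p := fun p hp =>
    hθfix p (by simp only [hV, hp, zero_smul])
  -- `β` does not vanish along a flow line unless it vanishes initially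
  have hβne : ∀ p t, β p ≠ 0 → β (θ (t, p)) ≠ 0 := by
    intro p t hp h0
    apply hp
    have h1 : θ (-t, θ (t, p)) = θ (t, p) := hfixβ _ h0 (-t)
    rw [hθadd, neg_add_cancel, hθ0] at h1
    rw [h1]
    exact h0
  -- flow lines from points with `β ≠ 0` are future timelike curves
  have htl : ∀ p, β p ≠ 0 → ∀ S : Set ℝ, g.IsFutureTimelikeCurveOn τ (fun s => θ (s, p)) S := by
    intro p hp S s _
    have hpos : 0 < β (θ (s, p)) := lt_of_le_of_ne (hβnn _) (hβne p s hp).symm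
    exact LorentzianMetric.futureTimelikeAt_of_hasMFDerivAt rfl (hθint p s)
      ((τ.isTimelike _).smul hpos.ne') ((τ.isFutureDirected_vectorField _).smul hpos)
  -- a point with `β ≠ 0` lies in the chronological future of its pushed images
  have hfut : ∀ p, β p ≠ 0 → ∀ t : ℝ, 0 < t → p ∈ g.chronologicalFuture τ {θ (-t, p)} := by
    intro p hp t ht
    refine ⟨θ (-t, p), rfl, fun s => θ (s, θ (-t, p)), 0, t, ht, htl _ (hβne p (-t) hp) _,
      ?_, ?_⟩
    · simp only [hθ0]
    · simp only [hθadd, add_neg_cancel, hθ0]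
  refine ⟨fun z => θ (-z.1, z.2), ?_, ?_, ?_, ?_, ?_, ?_⟩
  · exact hθc.continuous.comp (by fun_prop)
  · intro p
    simp only [neg_zero, hθ0]
  · intro p hp t
    exact hfixβ p (hβ0 (Or.inl hp)) _
  · intro p hp t ht
    show θ (-t, p) ∈ closure C
    by_cases hb : β p = 0
    · rw [hfixβ p hb]
      exact hp
    · rcases ht.eq_or_lt with rfl | ht'
      · simpa only [neg_zero, hθ0] using hp
      · exact subset_closure (mem_chronologicalPast_of_mem_closure hp (hfut p hb t ht'))
  · intro p hp t ht
    show θ (-t, p) ∈ C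
    by_cases hb : β p = 0
    · rw [hfixβ p hb]
      exact hp
    · rcases ht.eq_or_lt with rfl | ht'
      · simpa only [neg_zero, hθ0] using hp
      · exact mem_chronologicalPast_of_mem_closure (subset_closure hp) (hfut p hb t ht')
  · rintro p ⟨hpK, hpcl⟩ t ht
    show θ (-t, p) ∈ C
    have hb : β p ≠ 0 := by
      have h1 : β p = 1 := hβ1 hpK
      rw [h1]
      exact one_ne_zero
    exact mem_chronologicalPast_of_mem_closure hpcl (hfut p hb t ht)

/-- **The closure of a path connected chronological past is path connected**: a point `y` of
`cl I⁻(A)` is joined inside `cl I⁻(A)` to its push `P (1, y) ∈ I⁻(A)` (`exists_pastPush` with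
`K = {y}`). -/
theorem isPathConnected_closure_chronologicalPast (hn : 1 ≤ n) {A : Set M}
    (hC : IsPathConnected (g.chronologicalPast τ A)) :
    IsPathConnected (closure (g.chronologicalPast τ A)) := by
  obtain ⟨x₀, hx₀, hjoin⟩ := hC
  refine ⟨x₀, subset_closure hx₀, fun {y} hy => ?_⟩
  obtain ⟨P, hPc, hP0, -, hPcl, -, hPK⟩ := exists_pastPush (g := g) (τ := τ) hn A
    (isCompact_singleton (x := y)) isClosed_empty (Set.empty_disjoint _)
  have h1 : P (1, y) ∈ g.chronologicalPast τ A := hPK y ⟨rfl, hy⟩ 1 one_pos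
  have hseg : JoinedIn (closure (g.chronologicalPast τ A)) y (P (1, y)) :=
    ⟨{ toFun := fun s => P (s, y)
       continuous_toFun := hPc.comp (continuous_subtype_val.prodMk continuous_const)
       source' := by simp only [Set.Icc.coe_zero, hP0]
       target' := by simp only [Set.Icc.coe_one] }, fun s => hPcl y hy s s.2.1⟩
  exact ((hjoin h1).mono subset_closure).trans hseg.symm

/-- **The closure of a simply connected chronological past is simply connected.**  `cl C`,
`C = I⁻(A)`, is path connected (`isPathConnected_closure_chronologicalPast`); fix `x₀ ∈ C`.  A loop
`γ` of `cl C` at `x₀` is homotopic inside `cl C`, relative to its endpoints, to its push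
`P (1, γ ·)` (`exists_pastPush` with `K = range γ ∖ C`, compact as `C` is open, and `Z = {x₀}`),
through `(t, s) ↦ P (t, γ s)`; the pushed loop lies in `C` (points of `γ` in `C` stay in `C`,
points off `C` are in `K`), where it is null-homotopic; one base point suffices
(`simplyConnectedSpace_of_loops_nullhomotopic_at`). -/
theorem simplyConnectedSpace_closure_chronologicalPast (hn : 1 ≤ n) {A : Set M}
    (hC : SimplyConnectedSpace ↥(g.chronologicalPast τ A)) :
    SimplyConnectedSpace ↥(closure (g.chronologicalPast τ A)) := by
  set C : Set M := g.chronologicalPast τ A with hCdef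
  have hCo : IsOpen C := LorentzianMetric.isOpen_chronologicalPast_of_boundaryless g τ A
  have hCpc : IsPathConnected C := isPathConnected_iff_pathConnectedSpace.2 inferInstance
  haveI : PathConnectedSpace ↥(closure C) :=
    isPathConnected_iff_pathConnectedSpace.1 (isPathConnected_closure_chronologicalPast hn hCpc)
  obtain ⟨x₀, hx₀⟩ := hCpc.nonempty
  have hCD : C ⊆ closure C := subset_closure
  let f : C(↥C, ↥(closure C)) := ⟨Set.inclusion hCD, continuous_inclusion hCD⟩
  have hf : ∀ y : ↥C, ((f y : ↥(closure C)) : M) = y := fun _ => rfl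
  apply simplyConnectedSpace_of_loops_nullhomotopic_at (f ⟨x₀, hx₀⟩)
  intro γ
  -- the loop read in `M`
  obtain ⟨p, hp⟩ : ∃ p : Path x₀ x₀, ∀ s, p s = (γ s : M) :=
    ⟨γ.map continuous_subtype_val, fun _ => rfl⟩
  have hpD : ∀ s, p s ∈ closure C := fun s => by rw [hp]; exact (γ s).2
  -- the push for `K = range p ∖ C`, `Z = {x₀}`
  have hK : IsCompact (range p ∩ Cᶜ) := (isCompact_range p.continuous).inter_right hCo.isClosed_compl
  obtain ⟨P, hPc, hP0, hPZ, hPcl, hPC, hPK⟩ := exists_pastPush (g := g) (τ := τ) hn A hK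
    isClosed_singleton (Set.disjoint_singleton_left.2 fun h => h.2 hx₀)
  have hx₀fix : ∀ t, P (t, x₀) = x₀ := fun t => hPZ x₀ rfl t
  -- the pushed loop lies in `C`
  have hq : ∀ s, P (1, p s) ∈ C := fun s => by
    by_cases hs : p s ∈ C
    · exact hPC _ hs 1 zero_le_one
    · exact hPK _ ⟨⟨mem_range_self s, hs⟩, hpD s⟩ 1 one_pos
  obtain ⟨q, hq'⟩ : ∃ q : Path (⟨x₀, hx₀⟩ : ↥C) ⟨x₀, hx₀⟩, ∀ s, (q s : M) = P (1, p s) :=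
    ⟨{ toFun := fun s => ⟨P (1, p s), hq s⟩
       continuous_toFun := (hPc.comp (continuous_const.prodMk p.continuous)).subtype_mk _
       source' := Subtype.ext (by simp only [p.source, hx₀fix])
       target' := Subtype.ext (by simp only [p.target, hx₀fix]) }, fun _ => rfl⟩
  -- the pushed loop contracts in `C`, hence in `closure C`
  have h1 : (q.map f.continuous).Homotopic (Path.refl (f ⟨x₀, hx₀⟩)) :=
    (SimplyConnectedSpace.paths_homotopic q (Path.refl _)).map f
  -- `γ` is homotopic to the pushed loop inside `closure C`
  have h2 : γ.Homotopic (q.map f.continuous) :=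
    ⟨{ toFun := fun z => ⟨P (z.1, p z.2), hPcl _ (hpD z.2) _ z.1.2.1⟩
       continuous_toFun := (hPc.comp ((continuous_subtype_val.comp continuous_fst).prodMk
         (p.continuous.comp continuous_snd))).subtype_mk _
       map_zero_left := fun s => Subtype.ext (by simp only [Set.Icc.coe_zero, hP0, hp]; rfl)
       map_one_left := fun s => Subtype.ext (by
         simp only [Set.Icc.coe_one, Path.coe_toContinuousMap, Path.map_coe, Function.comp_apply,
           hf, hq'])
       prop' := fun t s hs => by
         apply Subtype.ext
         simp only [Set.mem_insert_iff, Set.mem_singleton_iff] at hs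
         rcases hs with rfl | rfl
         · simp only [ContinuousMap.coe_mk, p.source, hx₀fix, Path.coe_toContinuousMap,
             γ.source, hf]
         · simp only [ContinuousMap.coe_mk, p.target, hx₀fix, Path.coe_toContinuousMap,
             γ.target, hf] }⟩
  exact h2.trans h1

end General

/-! ## The registered stub -/

/-- **TOP-D (closure).** For a future-presented stationary black hole, `doc ∪ 𝓔⁺ = cl doc` is simply
connected when `doc` is: future-presentation `I⁺(M_ext) = M` makes `doc = I⁻(M_ext)` an open past
set and `𝓔⁺` its frontier, so `doc ∪ 𝓔⁺ = cl I⁻(M_ext)`, and loops are pushed into `doc` by a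
compactly supported past-timelike flow (`simplyConnectedSpace_closure_chronologicalPast`). -/
theorem stub_top_closure : ∀ (𝓑 : StationaryAFBlackHole.{0}) [𝓑.metric.HasLeviCivita], (∀ p : 𝓑.carrier, p ∈ 𝓑.metric.chronologicalFuture 𝓑.timeOrientation 𝓑.Mext) → SimplyConnectedSpace ↥𝓑.doc → SimplyConnectedSpace ↥(𝓑.doc ∪ 𝓑.horizon) := by
  intro 𝓑 _ hfut hsc
  have hdoc : 𝓑.doc = 𝓑.metric.chronologicalPast 𝓑.timeOrientation 𝓑.Mext :=
    Set.ext fun x => ⟨fun h => h.2, fun h => ⟨hfut x, h⟩⟩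
  have hhor : 𝓑.horizon = frontier (𝓑.metric.chronologicalPast 𝓑.timeOrientation 𝓑.Mext) :=
    Set.ext fun x => ⟨fun h => h.1, fun h => ⟨h, hfut x⟩⟩
  have hD : 𝓑.doc ∪ 𝓑.horizon = closure (𝓑.metric.chronologicalPast 𝓑.timeOrientation 𝓑.Mext) := by
    rw [hhor, hdoc, ← closure_eq_self_union_frontier]
  rw [hD]
  rw [hdoc] at hsc
  have hn : (1 : ℕ∞ω) ≤ ∞ := WithTop.coe_le_coe.mpr le_top
  exact simplyConnectedSpace_closure_chronologicalPast hn hsc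

end Summit.FinalStateConjecture.FinalStateConjecture.Theorems.HawkingExtensionIsKerr.SketchIdeator2

end
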